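import Summits.CriticalPhenomena.PercolationContinuityZ3.Theorems.PercAnnulusCrossingIICMeanDegreeFinite
import Summits.CriticalPhenomena.PercolationContinuityZ3.Theorems.PercAnnulusCrossingIICRootLeaf
import Summits.CriticalPhenomena.PercolationContinuityZ3.Theorems.PercAnnulusCrossingIICBackboneThin
import HarnessLib

/-!
# THE DEGREE OF THE ROOT OF KESTEN'S IIC — master statement and the branching bound `ν(deg ≥ 3) ≥ (1−p)^{2d−1}/(2d−2)` (lane RSW3, p1 gen 11)

builds on p205010 (kernel theorem, internal audit signed; external expert review pending) — used through `θ(p_c) = 0` in the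
`criticalProbI` / `ℤ²` master statements; `iicMeasure_le_real_degree_ge_three` is stated at any `p` with `θ(p) = 0` and (A2)□ at
aspect `(s, L)`, `2 ≤ s`.

Seat `prim-rsw3-p1` (gen 11); memo `run/shared/lean/prim/rsw3/P1-QM.md` §24.  Helper file; no definitions, no sorries.  ONE CITATION POINT
for the gen 11 files `…ClusterScreening` (p304627), `…IICMeanDegree` (p305156), `…IICBackboneThin` (p305647), `…IICMeanDegreeStrict`
(p306126), `…IICCutVertices` (p306387), `…IICMeanDegreeFinite`, `…IICRootLeaf`, plus one new inequality:

* `sum_indicator_eq_card_filter` — the lattice degree `deg(0) = #{y ∼ 0 : s(0,y) open}` as a sum of indicators;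
* **`iicMeasure_le_real_degree_ge_three`** — **BRANCHING AT THE ROOT: `ν(deg(0) ≥ 3) ≥ (1 − p)^{2d−1}/(2d − 2)`** (`θ(p) = 0`, (A2)□,
  `d ≥ 2`): pointwise `deg ≤ 2 − 1{deg = 1} + (2d−2)·1{deg ≥ 3}`, integrate, and use `E_ν deg ≥ 2` with `ν(deg = 1) ≥ (1−p)^{2d−1}`;
* `adj_and_sdiff_notMem_percolatesAt_of_leafAt`, **`iicMeasure_le_real_screened`** — A LEAF ROOT HANGS OFF ITS NEIGHBOUR: for every IIC
  measure (any `p`), `ν(some neighbour screens the root) ≥ (1−p)^{2d−1}`; **`iicMeasure_le_tsum_screens`** — with `…IICMeanDegree`'s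
  transport identity, the root screens on average `≥ (1−p)^{2d−1}` neighbours ((A2)□ + `θ(p) = 0`);
* **`iicMeasure_rootDegree_criticalProbI`** — at `p_c(ℤ^d)` under (A2)□ (`d ≥ 2`, `2 ≤ s ≤ L`), for every IIC probability measure:
  mean degree `> 2` (open-graph and lattice forms), every root edge open w.p. `> 1/d`, `ν(deg = 1) ≥ (1−p_c)^{2d−1}`,
  `ν(deg = 2d) ≥ p_c^{2d}`, `ν(deg ≥ 3) ≥ (1−p_c)^{2d−1}/(2d−2)`, eventually `E_{p_c}[deg 0 | 0 ↔ ∂ⁱⁿΛ(n)] > 2`, and the thin backbone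
  `ν(T_n(v)) ≤ C τ_{p_c}(0,v)`;
* **`iicMeasure_rootDegree_Z2`** — the planar IIC, UNCONDITIONALLY: mean root degree `> 2`, every root edge open w.p. `> 1/2`,
  `ν(deg = 1) ≥ 1/8`, `ν(deg = 4) ≥ 1/16`, `ν(deg ≥ 3) ≥ 1/16`, thin backbone.

References: D. Aldous, R. Lyons, EJP 12 (2007) §6 (Thm. 6.1, 6.2); H. Kesten, PTRF 73 (1986) Thm. (3), Thm. (8); D. Basu, A. Sapozhnikov,
ECP 22 (2017) no. 26, Thm. 1.1; G. Grimmett, *Percolation* (1999) §1.4, §11.7.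
-/

noncomputable section

namespace Summit.CriticalPhenomena.PercolationContinuityZ3.Theorems.Crossing

open MeasureTheory Filter Topology Literature.Probability.Percolation Literature.Probability.LatticeModels
open Literature.Probability.Percolation.DCT16
open Summit.CriticalPhenomena.PercolationContinuityZ3.Theorems.SurfaceTension
open scoped Literature.Probability.Percolation ENNReal

variable {d : ℕ}

open Classical in
/-- The lattice degree of the origin as a sum of indicators equals the number of open lattice edges at the origin. [folklore] -/
theorem sum_indicator_eq_card_filter (ω : BondConfig (Site d)) :
    ∑ y ∈ (zdGraph d).neighborFinset 0, {ω' : BondConfig (Site d) | s((0 : Site d), y) ∈ ω'}.indicator (1 : BondConfig (Site d) → ℝ) ω =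
      ((((zdGraph d).neighborFinset (0 : Site d)).filter fun y => s((0 : Site d), y) ∈ ω).card : ℝ) := by
  rw [Finset.card_filter, Nat.cast_sum]
  refine Finset.sum_congr rfl fun y _ => ?_
  by_cases h : s((0 : Site d), y) ∈ ω
  · rw [Set.indicator_of_mem (show ω ∈ {ω' : BondConfig (Site d) | s((0 : Site d), y) ∈ ω'} from h), if_pos h]; simp
  · rw [Set.indicator_of_notMem (show ω ∉ {ω' : BondConfig (Site d) | s((0 : Site d), y) ∈ ω'} from h), if_neg h]; simp

open Classical in
/-- **BRANCHING AT THE ROOT**: `θ(p) = 0`, (A2)□ at aspect `(s,L)` (`2 ≤ s`), `ν` an IIC probability measure at `p` (`0 < p`, `d ≥ 2`) ⇒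
**`ν(deg(0) ≥ 3) ≥ (1 − p)^{2d−1}/(2d − 2)`** (`1/16` at `p_c(ℤ²)`): from `E_ν deg ≥ 2` (`…IICMeanDegree`) and `ν(deg = 1) ≥ (1−p)^{2d−1}`
(`…IICRootLeaf`), since pointwise `deg ≤ 2 − 1{deg = 1} + (2d−2)·1{deg ≥ 3}`. [cite: AldousLyons2007, §6 Thm. 6.1] [cite: Kesten1986, Thm. (3)] -/
theorem iicMeasure_le_real_degree_ge_three (hd : 2 ≤ d) (p : unitInterval) (hp : 0 < (p : ℝ)) (hθ : theta (zdGraph d) 0 p = 0)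
    {s L : ℕ} (hs : 2 ≤ s) {ϰ : ℝ} (hϰ : 0 < ϰ) (hA2 : SetToSetQuasiMultAspectAt d p s L ϰ)
    {ν : Measure (BondConfig (Site d))} [IsProbabilityMeasure ν]
    (hν : ∀ (F : Finset (Sym2 (Site d))) (E : Set (BondConfig (Site d))), MeasurableSet E → DeterminedBy E ↑F →
      Tendsto (fun n : ℕ => (bondPercolation (zdGraph d) p).real (E ∩ siteToBoundary d n) / oneArmProb d p n)
        atTop (𝓝 (ν.real E))) :
    (1 - (p : ℝ)) ^ (2 * d - 1) / (2 * d - 2) ≤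
      ν.real {ω : BondConfig (Site d) | 3 ≤ (((zdGraph d).neighborFinset (0 : Site d)).filter fun y => s((0 : Site d), y) ∈ ω).card} := by
  have hd1 : 1 ≤ d := by omega
  set D : BondConfig (Site d) → ℝ := fun ω => ∑ y ∈ (zdGraph d).neighborFinset 0,
    {ω' : BondConfig (Site d) | s((0 : Site d), y) ∈ ω'}.indicator (1 : BondConfig (Site d) → ℝ) ω with hD
  set L1 : Set (BondConfig (Site d)) := {ω | (((zdGraph d).neighborFinset (0 : Site d)).filter fun y => s((0 : Site d), y) ∈ ω).card = 1} with hL1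
  set B3 : Set (BondConfig (Site d)) := {ω | 3 ≤ (((zdGraph d).neighborFinset (0 : Site d)).filter fun y => s((0 : Site d), y) ∈ ω).card}
    with hB3
  have hDm : Measurable D := Finset.measurable_sum _ fun y _ => measurable_one.indicator (measurableSet_mem _)
  have hDcard : ∀ ω, D ω = ((((zdGraph d).neighborFinset (0 : Site d)).filter fun y => s((0 : Site d), y) ∈ ω).card : ℝ) :=
    fun ω => sum_indicator_eq_card_filter ω
  have hL1m : MeasurableSet L1 := by
    have h : L1 = D ⁻¹' {1} := by
      ext ω; simp only [hL1, Set.mem_setOf_eq, Set.mem_preimage, Set.mem_singleton_iff, hDcard]; norm_cast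
    rw [h]; exact hDm (measurableSet_singleton 1)
  have hB3m : MeasurableSet B3 := by
    have h : B3 = D ⁻¹' Set.Ici 3 := by
      ext ω; simp only [hB3, Set.mem_setOf_eq, Set.mem_preimage, Set.mem_Ici, hDcard]; norm_cast
    rw [h]; exact hDm measurableSet_Ici
  -- pointwise: `D ≤ 2 − 1_{L1} + (2d − 2) 1_{B3}`
  have hpt : ∀ ω, D ω ≤ 2 - L1.indicator (1 : BondConfig (Site d) → ℝ) ω + (2 * d - 2) * B3.indicator (1 : BondConfig (Site d) → ℝ) ω := by
    intro ω
    rw [hDcard]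
    set k := (((zdGraph d).neighborFinset (0 : Site d)).filter fun y => s((0 : Site d), y) ∈ ω).card with hk
    have hk2d : k ≤ 2 * d := (Finset.card_filter_le _ _).trans (card_neighborFinset_zdGraph_holds (0 : Site d)).le
    have hd2 : (2 : ℝ) ≤ d := by exact_mod_cast hd
    by_cases h1 : k = 1
    · rw [Set.indicator_of_mem (show ω ∈ L1 from h1), Pi.one_apply]
      have : B3.indicator (1 : BondConfig (Site d) → ℝ) ω = 0 := Set.indicator_of_notMem (show ω ∉ B3 from by
        simp only [hB3, Set.mem_setOf_eq, ← hk]; omega) _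
      rw [this, h1]; norm_num
    · rw [Set.indicator_of_notMem (show ω ∉ L1 from h1)]
      by_cases h3 : 3 ≤ k
      · rw [Set.indicator_of_mem (show ω ∈ B3 from h3), Pi.one_apply]
        have : (k : ℝ) ≤ 2 * d := by exact_mod_cast hk2d
        linarith
      · rw [Set.indicator_of_notMem (show ω ∉ B3 from h3)]
        have : (k : ℝ) ≤ 2 := by exact_mod_cast (by omega : k ≤ 2)
        linarith
  -- integrate
  have h2 : (2 : ℝ) ≤ ∫ ω, D ω ∂ν := iicMeasure_two_le_integral_latticeDegree hd1 p hp hθ hs hϰ hA2 hν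
  have hint : ∫ ω, (2 - L1.indicator (1 : BondConfig (Site d) → ℝ) ω + (2 * d - 2) * B3.indicator (1 : BondConfig (Site d) → ℝ) ω) ∂ν =
      2 - ν.real L1 + (2 * d - 2) * ν.real B3 := by
    have hiL : Integrable (fun ω => L1.indicator (1 : BondConfig (Site d) → ℝ) ω) ν := (integrable_const (1 : ℝ)).indicator hL1m
    have hiB : Integrable (fun ω => (2 * d - 2 : ℝ) * B3.indicator (1 : BondConfig (Site d) → ℝ) ω) ν :=
      ((integrable_const (1 : ℝ)).indicator hB3m).const_mul _
    have hi1 : Integrable (fun ω => (2 : ℝ) - L1.indicator (1 : BondConfig (Site d) → ℝ) ω) ν := (integrable_const (2 : ℝ)).sub hiL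
    have e1 : ∫ ω, (2 - L1.indicator (1 : BondConfig (Site d) → ℝ) ω + (2 * d - 2) * B3.indicator (1 : BondConfig (Site d) → ℝ) ω) ∂ν =
        ∫ ω, (2 - L1.indicator (1 : BondConfig (Site d) → ℝ) ω) ∂ν + ∫ ω, (2 * d - 2 : ℝ) * B3.indicator (1 : BondConfig (Site d) → ℝ) ω ∂ν :=
      integral_add hi1 hiB
    have e2 : ∫ ω, (2 - L1.indicator (1 : BondConfig (Site d) → ℝ) ω) ∂ν = ∫ _, (2 : ℝ) ∂ν - ∫ ω, L1.indicator (1 : BondConfig (Site d) → ℝ) ω ∂ν :=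
      integral_sub (integrable_const (2 : ℝ)) hiL
    have e3 : ∫ ω, (2 * d - 2 : ℝ) * B3.indicator (1 : BondConfig (Site d) → ℝ) ω ∂ν = (2 * d - 2 : ℝ) * ∫ ω, B3.indicator (1 : BondConfig (Site d) → ℝ) ω ∂ν :=
      integral_const_mul _ _
    rw [e1, e2, e3, integral_const, integral_indicator_one hL1m, integral_indicator_one hB3m, probReal_univ, one_smul]
  have hDi : Integrable D ν := by
    refine Integrable.of_bound hDm.aestronglyMeasurable (2 * d) (Eventually.of_forall fun ω => ?_)
    rw [Real.norm_eq_abs, abs_of_nonneg (Finset.sum_nonneg fun y _ => Set.indicator_nonneg (fun _ _ => zero_le_one) _), hDcard]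
    exact_mod_cast (Finset.card_filter_le _ _).trans (card_neighborFinset_zdGraph_holds (0 : Site d)).le
  have hle : ∫ ω, D ω ∂ν ≤ 2 - ν.real L1 + (2 * d - 2) * ν.real B3 := by
    rw [← hint]
    have hi : Integrable (fun ω => 2 - L1.indicator (1 : BondConfig (Site d) → ℝ) ω + (2 * d - 2) * B3.indicator (1 : BondConfig (Site d) → ℝ) ω) ν :=
      ((integrable_const (2 : ℝ)).sub ((integrable_const (1 : ℝ)).indicator hL1m)).add (((integrable_const (1 : ℝ)).indicator hB3m).const_mul _)
    exact integral_mono hDi hi hpt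
  have hleaf : (1 - (p : ℝ)) ^ (2 * d - 1) ≤ ν.real L1 := iicMeasure_le_real_degree_eq_one hd1 p hp hν
  have hd' : (0 : ℝ) < 2 * d - 2 := by
    have : (2 : ℝ) ≤ d := by exact_mod_cast hd
    linarith
  rw [div_le_iff₀ hd']
  nlinarith

/-! ## A leaf root hangs off its neighbour: the root is screened with probability `≥ (1−p)^{2d−1}` -/

/-- On lattice configurations, if `s(0,y)` is the only open lattice edge at the origin then `y` SCREENS `0`: the origin is isolated in
`ω ∖ E(y)`. [folklore] -/
theorem adj_and_sdiff_notMem_percolatesAt_of_leafAt {ω : BondConfig (Site d)} (hω : ω ⊆ (zdGraph d).edgeSet) {y : Site d}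
    (hy : y ∈ (zdGraph d).neighborFinset (0 : Site d))
    (hleaf : ω ∈ ({ω : BondConfig (Site d) | s((0 : Site d), y) ∈ ω} ∩
      {ω | ∀ e ∈ (((zdGraph d).neighborFinset (0 : Site d)).erase y).image (fun y' => s((0 : Site d), y')), e ∉ ω})) :
    (openGraph ω).Adj y 0 ∧ ω \ {e : Sym2 (Site d) | y ∈ e} ∉ percolatesAt (0 : Site d) := by
  classical
  have hy0 : (zdGraph d).Adj 0 y := (SimpleGraph.mem_neighborFinset _ _ _).1 hy
  refine ⟨((openGraph_adj ω 0 y).2 ⟨hleaf.1, hy0.ne⟩).symm, ?_⟩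
  -- the origin has no neighbour in `ω ∖ E(y)`
  have hno : ∀ z, ¬ (openGraph (ω \ {e : Sym2 (Site d) | y ∈ e})).Adj 0 z := by
    intro z hz
    obtain ⟨hz0, hyne0, hynez⟩ := (openGraph_sdiff_setOf_mem_adj ω y 0 z).1 hz
    have hzN : z ∈ ((zdGraph d).neighborFinset (0 : Site d)).erase y :=
      Finset.mem_erase.2 ⟨Ne.symm hynez, (SimpleGraph.mem_neighborFinset _ _ _).2 (adj_of_openGraph_adj hω hz0)⟩
    exact hleaf.2 _ (Finset.mem_image.2 ⟨z, hzN, rfl⟩) ((openGraph_adj ω 0 z).1 hz0).1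
  have hcl : openCluster (ω \ {e : Sym2 (Site d) | y ∈ e}) (0 : Site d) ⊆ {0} := fun z hz =>
    mem_of_reachable_of_forall_adj (G := openGraph (ω \ {e : Sym2 (Site d) | y ∈ e})) (D := ({0} : Set (Site d)))
      (fun a b ha hab => by rw [Set.mem_singleton_iff] at ha; subst ha; exact (hno b hab).elim) hz rfl
  exact fun h => h ((Set.finite_singleton (0 : Site d)).subset hcl)

/-- **THE ROOT OF THE IIC HANGS OFF A NEIGHBOUR WITH PROBABILITY `≥ (1 − p)^{2d−1}`**: for EVERY IIC probability measure `ν` at `p` (`0 < p`,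
`d ≥ 1`; limit property only), `(1−p)^{2d−1} ≤ ν(some neighbour y screens 0)` — a leaf root is screened by its neighbour
(`…IICRootLeaf`).  With `iicMeasure_tsum_screened_eq` (unimodularity): the root screens, on average, at least `(1−p)^{2d−1}` of its
neighbours. [cite: Kesten1986, Thm. (3)] [cite: AldousLyons2007, §6 Thm. 6.1] -/
theorem iicMeasure_le_real_screened (hd : 1 ≤ d) (p : unitInterval) (hp : 0 < (p : ℝ)) {ν : Measure (BondConfig (Site d))}
    [IsProbabilityMeasure ν]
    (hν : ∀ (F : Finset (Sym2 (Site d))) (E : Set (BondConfig (Site d))), MeasurableSet E → DeterminedBy E ↑F →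
      Tendsto (fun n : ℕ => (bondPercolation (zdGraph d) p).real (E ∩ siteToBoundary d n) / oneArmProb d p n)
        atTop (𝓝 (ν.real E))) :
    (1 - (p : ℝ)) ^ (2 * d - 1) ≤
      ν.real (⋃ y : Site d, {ω | (openGraph ω).Adj y 0 ∧ ω \ {e : Sym2 (Site d) | y ∈ e} ∉ percolatesAt (0 : Site d)}) := by
  refine (iicMeasure_le_real_leaf hd p hp hν).trans ?_
  rw [measureReal_def, measureReal_def]
  refine ENNReal.toReal_mono (measure_ne_top _ _) (measure_mono_ae ?_)
  filter_upwards [iicMeasure_ae_subset_edgeSet p hν] with ω hω hleaf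
  have hleaf' : ω ∈ ⋃ y ∈ (zdGraph d).neighborFinset (0 : Site d), ({ω : BondConfig (Site d) | s((0 : Site d), y) ∈ ω} ∩
      {ω | ∀ e ∈ (((zdGraph d).neighborFinset (0 : Site d)).erase y).image (fun y' => s((0 : Site d), y')), e ∉ ω}) := hleaf
  rw [Set.mem_iUnion₂] at hleaf'
  obtain ⟨y, hy, hmem⟩ := hleaf'
  show ω ∈ ⋃ y : Site d, {ω | (openGraph ω).Adj y 0 ∧ ω \ {e : Sym2 (Site d) | y ∈ e} ∉ percolatesAt (0 : Site d)}
  exact Set.mem_iUnion.2 ⟨y, adj_and_sdiff_notMem_percolatesAt_of_leafAt hω hy hmem⟩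

/-- **THE ROOT SCREENS, ON AVERAGE, AT LEAST `(1−p)^{2d−1}` NEIGHBOURS**: `θ(p) = 0`, (A2)□ at aspect `(s,L)` (`2 ≤ s`), `ν` an IIC
probability measure (`0 < p`, `d ≥ 1`) ⇒ `(1−p)^{2d−1} ≤ Σ_y ν(0 screens y)` (in `[0,∞]`): the transport identity
`Σ_y ν(0 screens y) = Σ_y ν(y screens 0)` (`iicMeasure_tsum_screened_eq`) and `iicMeasure_le_real_screened`.
[cite: AldousLyons2007, §2 (MTP)] [cite: Kesten1986, Thm. (3)] -/
theorem iicMeasure_le_tsum_screens (hd : 1 ≤ d) (p : unitInterval) (hp : 0 < (p : ℝ)) (hθ : theta (zdGraph d) 0 p = 0)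
    {s L : ℕ} (hs : 2 ≤ s) {ϰ : ℝ} (hϰ : 0 < ϰ) (hA2 : SetToSetQuasiMultAspectAt d p s L ϰ)
    {ν : Measure (BondConfig (Site d))} [IsProbabilityMeasure ν]
    (hν : ∀ (F : Finset (Sym2 (Site d))) (E : Set (BondConfig (Site d))), MeasurableSet E → DeterminedBy E ↑F →
      Tendsto (fun n : ℕ => (bondPercolation (zdGraph d) p).real (E ∩ siteToBoundary d n) / oneArmProb d p n)
        atTop (𝓝 (ν.real E))) :
    ENNReal.ofReal ((1 - (p : ℝ)) ^ (2 * d - 1)) ≤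
      ∑' y : Site d, ν {ω | (openGraph ω).Adj 0 y ∧ ω \ {e : Sym2 (Site d) | (0 : Site d) ∈ e} ∉ percolatesAt y} := by
  rw [iicMeasure_tsum_screened_eq hd p hp hθ hs hϰ hA2 hν]
  refine le_trans ?_ (measure_iUnion_le _)
  rw [← ofReal_measureReal]
  exact ENNReal.ofReal_le_ofReal (iicMeasure_le_real_screened hd p hp hν)

open Classical in
/-- **THE ROOT DEGREE OF KESTEN'S IIC AT `p_c(ℤ^d)` UNDER (A2)□ — ONE CITATION POINT** (`d ≥ 2`, aspect `(s,L)`, `2 ≤ s ≤ L`; every IIC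
probability measure `ν`; `deg = #{y ∼ 0 : s(0,y) open}`): (1) `E_ν[Σ_y 1{0 ∼ y open}] > 2`; (2) `E_ν deg > 2` (Bochner); (3) every root edge
is open w.p. `> 1/d`; (4) `ν(deg = 1) ≥ (1−p_c)^{2d−1}`; (5) `ν(deg = 2d) ≥ p_c^{2d}`; (6) `ν(deg ≥ 3) ≥ (1−p_c)^{2d−1}/(2d−2)`; (7) for all
large `n`, `E_{p_c}[deg 0 | 0 ↔ ∂ⁱⁿΛ(n)] > 2`; (8) the backbone is thin: `ν(T_n(v)) ≤ C τ(0,v)`.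
[cite: AldousLyons2007, §6 Thm. 6.1, Thm. 6.2] [cite: BasuSapozhnikov2017ECP, Thm. 1.1 and Remark 2.1] [cite: Kesten1986, Thm. (3), Thm. (8)] -/
theorem iicMeasure_rootDegree_criticalProbI (hd : 2 ≤ d) {s L : ℕ} (hs : 2 ≤ s) (hsL : s ≤ L) {ϰ : ℝ} (hϰ : 0 < ϰ)
    (hA2 : SetToSetQuasiMultAspectAt d (criticalProbI d) s L ϰ)
    {ν : Measure (BondConfig (Site d))} [IsProbabilityMeasure ν]
    (hν : ∀ (F : Finset (Sym2 (Site d))) (E : Set (BondConfig (Site d))), MeasurableSet E → DeterminedBy E ↑F →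
      Tendsto (fun n : ℕ => (bondPercolation (zdGraph d) (criticalProbI d)).real (E ∩ siteToBoundary d n) /
        oneArmProb d (criticalProbI d) n) atTop (𝓝 (ν.real E))) :
    (2 < ∫⁻ ω, ∑' y : Site d, {ω' : BondConfig (Site d) | (openGraph ω').Adj 0 y}.indicator (1 : BondConfig (Site d) → ℝ≥0∞) ω ∂ν) ∧
    (2 < ∫ ω, ∑ y ∈ (zdGraph d).neighborFinset 0,
      {ω' : BondConfig (Site d) | s((0 : Site d), y) ∈ ω'}.indicator (1 : BondConfig (Site d) → ℝ) ω ∂ν) ∧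
    (∀ y : Site d, (zdGraph d).Adj 0 y → 1 / (d : ℝ) < ν.real {ω | s((0 : Site d), y) ∈ ω}) ∧
    ((1 - ((criticalProbI d : unitInterval) : ℝ)) ^ (2 * d - 1) ≤
      ν.real {ω : BondConfig (Site d) | (((zdGraph d).neighborFinset (0 : Site d)).filter fun y => s((0 : Site d), y) ∈ ω).card = 1}) ∧
    (((criticalProbI d : unitInterval) : ℝ) ^ (2 * d) ≤
      ν.real {ω : BondConfig (Site d) | (((zdGraph d).neighborFinset (0 : Site d)).filter fun y => s((0 : Site d), y) ∈ ω).card = 2 * d}) ∧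
    ((1 - ((criticalProbI d : unitInterval) : ℝ)) ^ (2 * d - 1) / (2 * d - 2) ≤
      ν.real {ω : BondConfig (Site d) | 3 ≤ (((zdGraph d).neighborFinset (0 : Site d)).filter fun y => s((0 : Site d), y) ∈ ω).card}) ∧
    (∀ᶠ n : ℕ in atTop, 2 < ∑ y ∈ (zdGraph d).neighborFinset 0,
      (bondPercolation (zdGraph d) (criticalProbI d)).real ({ω : BondConfig (Site d) | s((0 : Site d), y) ∈ ω} ∩ siteToBoundary d n) /
        oneArmProb d (criticalProbI d) n) ∧
    (∃ C : ℝ, 0 < C ∧ ∀ (r n : ℕ), 2 * r + 3 ≤ n → ∀ v ∈ box d r,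
      ν.real (openConnIn (↑(box d n) : Set (Site d)) 0 v □
          {ω : BondConfig (Site d) | ∃ t ∈ innerBoundary (zdGraph d) (box d n), ω ∈ openConnIn (↑(box d n) : Set (Site d)) v t}) ≤
        C * (bondPercolation (zdGraph d) (criticalProbI d)).real (openConn (0 : Site d) v)) := by
  have hd1 : 1 ≤ d := by omega
  have hpc : 0 < ((criticalProbI d : unitInterval) : ℝ) := by
    exact_mod_cast Literature.Barriers.CriticalPhenomena.criticalProbI_pos' (d := d) (by omega)
  have hθ := CSH.percolationContinuity_allDimensions d hd
  obtain ⟨C, hC, hB⟩ := iicMeasure_real_backbone_at_le_criticalProbI hd hs hsL hϰ hA2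
  exact ⟨iicMeasure_two_lt_lintegral_degree hd _ hpc hθ hs hϰ hA2 hν,
    iicMeasure_two_lt_integral_latticeDegree hd _ hpc hθ hs hϰ hA2 hν,
    fun y hy => iicMeasure_inv_lt_real_rootEdge hd _ hpc hθ hs hϰ hA2 hν hy,
    iicMeasure_le_real_degree_eq_one hd1 _ hpc hν,
    iicMeasure_le_real_degree_eq_max hd1 _ hpc hν,
    iicMeasure_le_real_degree_ge_three hd _ hpc hθ hs hϰ hA2 hν,
    iicMeasure_eventually_two_lt_condDegree hd _ hpc hθ hs hϰ hA2 hν,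
    ⟨C, hC, fun r n hn v hv => hB ν hν r n hn v hv⟩⟩

open Classical in
/-- **THE ROOT DEGREE OF KESTEN'S PLANAR IIC, UNCONDITIONALLY** (every IIC probability measure at `p_c(ℤ²) = 1/2`): mean degree `> 2`, every
root edge open w.p. `> 1/2`, `ν(deg = 1) ≥ 1/8`, `ν(deg = 4) ≥ 1/16`, `ν(deg ≥ 3) ≥ 1/16`, the census form, and the thin backbone.
[cite: Kesten1986, Thm. (3), Thm. (8)] [cite: AldousLyons2007, §6 Thm. 6.1] -/
theorem iicMeasure_rootDegree_Z2 {ν : Measure (BondConfig (Site 2))} [IsProbabilityMeasure ν]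
    (hν : ∀ (F : Finset (Sym2 (Site 2))) (E : Set (BondConfig (Site 2))), MeasurableSet E → DeterminedBy E ↑F →
      Tendsto (fun n : ℕ => (bondPercolation (zdGraph 2) (criticalProbI 2)).real (E ∩ siteToBoundary 2 n) /
        oneArmProb 2 (criticalProbI 2) n) atTop (𝓝 (ν.real E))) :
    (2 < ∫ ω, ∑ y ∈ (zdGraph 2).neighborFinset 0,
      {ω' : BondConfig (Site 2) | s((0 : Site 2), y) ∈ ω'}.indicator (1 : BondConfig (Site 2) → ℝ) ω ∂ν) ∧
    (∀ y : Site 2, (zdGraph 2).Adj 0 y → 1 / (2 : ℝ) < ν.real {ω | s((0 : Site 2), y) ∈ ω}) ∧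
    ((1 : ℝ) / 8 ≤ ν.real {ω : BondConfig (Site 2) | (((zdGraph 2).neighborFinset (0 : Site 2)).filter fun y => s((0 : Site 2), y) ∈ ω).card = 1}) ∧
    ((1 : ℝ) / 16 ≤ ν.real {ω : BondConfig (Site 2) | (((zdGraph 2).neighborFinset (0 : Site 2)).filter fun y => s((0 : Site 2), y) ∈ ω).card = 4}) ∧
    ((1 : ℝ) / 16 ≤ ν.real {ω : BondConfig (Site 2) | 3 ≤ (((zdGraph 2).neighborFinset (0 : Site 2)).filter fun y => s((0 : Site 2), y) ∈ ω).card}) ∧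
    (∃ C : ℝ, 0 < C ∧ ∀ (r n : ℕ), 2 * r + 3 ≤ n → ∀ v ∈ box 2 r,
      ν.real (openConnIn (↑(box 2 n) : Set (Site 2)) 0 v □
          {ω : BondConfig (Site 2) | ∃ t ∈ innerBoundary (zdGraph 2) (box 2 n), ω ∈ openConnIn (↑(box 2 n) : Set (Site 2)) v t}) ≤
        C * (bondPercolation (zdGraph 2) (criticalProbI 2)).real (openConn (0 : Site 2) v)) := by
  obtain ⟨ϰ, hϰ, hA2⟩ := exists_setToSetQuasiMultAspectAt_two_of_criticalProbI_le
  obtain ⟨h1, h2, h3, h4, h5, h6, -, h8⟩ := iicMeasure_rootDegree_criticalProbI (d := 2) le_rfl (s := 9) (L := 77) (by norm_num)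
    (by norm_num) hϰ (hA2 _ le_rfl) hν
  have hpc : ((criticalProbI 2 : unitInterval) : ℝ) = 1 / 2 := by
    rw [SubpolynomialBlocking.StubBlockProbTwoPos.criticalProbI_two_eq_half, coe_half]
  refine ⟨h2, fun y hy => by simpa using h3 y hy, ?_, ?_, ?_, h8⟩
  · have : (1 - ((criticalProbI 2 : unitInterval) : ℝ)) ^ (2 * 2 - 1) = 1 / 8 := by rw [hpc]; norm_num
    rw [← this]; exact h4
  · have : ((criticalProbI 2 : unitInterval) : ℝ) ^ (2 * 2) = 1 / 16 := by rw [hpc]; norm_num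
    rw [← this]; exact h5
  · have : (1 - ((criticalProbI 2 : unitInterval) : ℝ)) ^ (2 * 2 - 1) / (2 * 2 - 2) = 1 / 16 := by rw [hpc]; norm_num
    rw [← this]; exact_mod_cast h6

end Summit.CriticalPhenomena.PercolationContinuityZ3.Theorems.Crossing

end
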